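import Summits.CriticalPhenomena.CardyFormulaZ2.Theorems.CardyFlipRussoVoronoiHubFromSmirnovHoloUniformBounds
import Summits.CriticalPhenomena.CardyFormulaZ2.Theorems.CardyFlipRussoVoronoiHubFromSmirnovUnivalentInverse

/-!
# Stub `transport_bilipschitz` of line `moebius-exact-delaunay-dilation-ward`
# (crux `VoronoiHubFromSmirnov`, stmt-CriticalPhenomena-6433)

UNIFORM LOCAL BI-LIPSCHITZ / LOCAL SURJECTIVITY PACKAGE OF A UNIVALENT MAP ON A COMPACT SET.
The one-arm route of S3b (conformal transport of Voronoi crossings, I. Benjamini, O. Schramm,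
*Conformal invariance of Voronoi percolation*, Comm. Math. Phys. 197 (1998) 75–107, §4) transports
nuclei by `T b = g (δ b) / δ`; the no-void, localisation and step-bound arguments need `T` and its
inverse to be uniformly Lipschitz on mesoscopic balls and `T` to be locally onto.  At the physical
scale this is the present statement: for `g` complex-differentiable and injective on the open `U`
and `Kc ⊆ U` compact there are `r > 0` and `Λ ≥ 1` such that, for every `x ∈ Kc`,
`closedBall x r ⊆ U`, `g` is `Λ`-Lipschitz and `Λ`-co-Lipschitz on `closedBall x r`,
`closedBall (g x) ρ ⊆ g '' closedBall x (Λ ρ)` whenever `0 ≤ ρ` and `Λ ρ ≤ r`, and the uniform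
injectivity modulus holds on the balls.

Proof (all from the two landed bricks of the line + the mean value inequality).
1. `holo_uniform_bounds g U Kc` gives `r₁, L, m, Λ₀` with `closedBall x r₁ ⊆ U`, the derivative
   data `HasDerivAt g (deriv g z) z`, `HasDerivAt (deriv g) (deriv (deriv g) z) z`,
   `m ≤ ‖deriv g z‖ ≤ Λ₀`, `‖deriv (deriv g) z‖ ≤ L` on the balls, and the injectivity modulus.
2. Upper bound: mean value inequality (`Convex.norm_image_sub_le_of_norm_hasDerivWithin_le`) on
   the convex ball with `‖deriv g‖ ≤ Λ₀`.
3. Lower bound: on `closedBall x r`, `r ≤ m / (2 (L + 1))`, the mean value inequality for `deriv g`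
   gives `‖deriv g y − deriv g x‖ ≤ L r ≤ m / 2`; applied to `y ↦ g y − y · deriv g x` it gives
   `‖g z − g w‖ ≥ (m − m/2) ‖z − w‖`, i.e. `dist z w ≤ (2/m) dist (g z) (g w)`.
4. Local surjectivity: `univalent_inverse g U` gives the holomorphic injective inverse
   `f = Function.invFunOn g U` on the open image `g '' U`; `holo_uniform_bounds f (g '' U) (g '' Kc)`
   gives `r₁', Λ'` with `closedBall (g x) r₁' ⊆ g '' U` and `‖deriv f‖ ≤ Λ'` there, so for
   `ρ ≤ r₁'` and `w ∈ closedBall (g x) ρ`: `g (f w) = w` and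
   `dist (f w) x = dist (f w) (f (g x)) ≤ Λ' ρ` (mean value inequality again).
5. Constants: `Λ = max (max Λ₀ (2/m)) (max Λ' 1)`, `r = min (min r₁ r₁') (m / (2 (L + 1)))`; all
   clauses are monotone in `Λ` (larger) and `r` (smaller), and `Λ ρ ≤ r`, `Λ ≥ 1` force `ρ ≤ r₁'`.

No new definitions, no new cited facts.
-/

namespace Summit.CriticalPhenomena.CardyFormulaZ2.Cruxes.VoronoiHubFromSmirnov.MoebiusExactDelaunayDilationWard

open Set Metric Function

/-- LOWER LIPSCHITZ BOUND FROM A DERIVATIVE PINNED NEAR A CONSTANT.  If `φ` has derivative `φ'`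
on the convex set `s`, `m ≤ ‖c‖` and `‖φ' y - c‖ ≤ ε` on `s`, then
`(m - ε) ‖z - w‖ ≤ ‖φ z - φ w‖` for `z, w ∈ s`: apply the mean value inequality to
`y ↦ φ y - y * c` (derivative `φ' y - c`, norm `≤ ε`) and the triangle inequality. [folklore] -/
theorem tb_lower_bound {φ φ' : ℂ → ℂ} {s : Set ℂ} (hs : Convex ℝ s) {c : ℂ} {m ε : ℝ}
    (hφ : ∀ y ∈ s, HasDerivAt φ (φ' y) y) (hc : m ≤ ‖c‖) (hε : ∀ y ∈ s, ‖φ' y - c‖ ≤ ε)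
    {z w : ℂ} (hz : z ∈ s) (hw : w ∈ s) : (m - ε) * ‖z - w‖ ≤ ‖φ z - φ w‖ := by
  have hψ : ∀ y ∈ s, HasDerivWithinAt (fun y => φ y - y * c) (φ' y - c) s y := fun y hy =>
    ((hφ y hy).sub (hasDerivAt_mul_const c)).hasDerivWithinAt
  have key : ‖(φ z - z * c) - (φ w - w * c)‖ ≤ ε * ‖z - w‖ :=
    hs.norm_image_sub_le_of_norm_hasDerivWithin_le hψ hε hw hz
  have h1 : (z - w) * c = (φ z - φ w) - ((φ z - z * c) - (φ w - w * c)) := by ring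
  have h2 : ‖z - w‖ * ‖c‖ ≤ ‖φ z - φ w‖ + ε * ‖z - w‖ :=
    calc ‖z - w‖ * ‖c‖ = ‖(z - w) * c‖ := (norm_mul _ _).symm
      _ = ‖(φ z - φ w) - ((φ z - z * c) - (φ w - w * c))‖ := by rw [← h1]
      _ ≤ ‖φ z - φ w‖ + ‖(φ z - z * c) - (φ w - w * c)‖ := norm_sub_le _ _
      _ ≤ ‖φ z - φ w‖ + ε * ‖z - w‖ := by linarith [key]
  have h3 : ‖z - w‖ * m ≤ ‖z - w‖ * ‖c‖ := mul_le_mul_of_nonneg_left hc (norm_nonneg _)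
  nlinarith [h2, h3, norm_nonneg (z - w)]

/-- **Uniform local bi-Lipschitz / local surjectivity package of a univalent map on a compact
set.**  Let `g : ℂ → ℂ` be complex-differentiable and injective on the open set `U` and `Kc ⊆ U`
compact.  Then there are `r > 0` and `Λ ≥ 1` such that for every `x ∈ Kc`: `closedBall x r ⊆ U`;
`dist (g z) (g w) ≤ Λ dist z w` and `dist z w ≤ Λ dist (g z) (g w)` for `z, w ∈ closedBall x r`;
`closedBall (g x) ρ ⊆ g '' closedBall x (Λ ρ)` whenever `0 ≤ ρ` and `Λ ρ ≤ r`; and for every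
`R₁ > 0` some `η > 0` bounds `dist (g z) (g w)` from below on the balls whenever `R₁ ≤ dist z w`.
Proof: the uniform `C²` package `holo_uniform_bounds` for `g` on `Kc` (upper bound and
injectivity modulus directly; lower bound by the mean value inequality applied to
`y ↦ g y - y · deriv g x` on balls of radius `≤ m / (2 (L + 1))`), and `holo_uniform_bounds` for
the holomorphic inverse `Function.invFunOn g U` (`univalent_inverse`) on the compact `g '' Kc`
inside the open image `g '' U` (local surjectivity). -/
theorem transport_bilipschitz : ∀ (g : ℂ → ℂ) (U Kc : Set ℂ), IsOpen U → IsCompact Kc → Kc ⊆ U → DifferentiableOn ℂ g U → Set.InjOn g U → ∃ r Λ : ℝ, 0 < r ∧ 1 ≤ Λ ∧ (∀ x ∈ Kc, Metric.closedBall x r ⊆ U) ∧ (∀ x ∈ Kc, ∀ z ∈ Metric.closedBall x r, ∀ w ∈ Metric.closedBall x r, dist (g z) (g w) ≤ Λ * dist z w) ∧ (∀ x ∈ Kc, ∀ z ∈ Metric.closedBall x r, ∀ w ∈ Metric.closedBall x r, dist z w ≤ Λ * dist (g z) (g w)) ∧ (∀ x ∈ Kc, ∀ ρ : ℝ, 0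 ≤ ρ → Λ * ρ ≤ r → Metric.closedBall (g x) ρ ⊆ g '' Metric.closedBall x (Λ * ρ)) ∧ (∀ R₁ : ℝ, 0 < R₁ → ∃ η : ℝ, 0 < η ∧ ∀ x ∈ Kc, ∀ z ∈ Metric.closedBall x r, ∀ w ∈ Metric.closedBall x r, R₁ ≤ dist z w → η ≤ dist (g z) (g w)) := by
  intro g U Kc hU hKc hKcU hd hi
  -- Step 1: the uniform `C²` package of `g` on `Kc`.
  obtain ⟨r₁, L, m, Λ₀, hr₁, hL, hm, -, hballU, hder, -, hinj⟩ :=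
    holo_uniform_bounds g U Kc hU hKc hKcU hd hi
  -- Step 2: the inverse on the open image and its uniform package on the compact `g '' Kc`.
  obtain ⟨hUo, hfd, hfi, hfg, hgf, -⟩ := univalent_inverse g U hU hd hi
  have hKc' : IsCompact (g '' Kc) := hKc.image_of_continuousOn (hd.continuousOn.mono hKcU)
  have hKcU' : g '' Kc ⊆ g '' U := image_mono hKcU
  obtain ⟨r₁', L', m', Λ', hr₁', -, hm', hmΛ', hballU', hder', -, -⟩ :=
    holo_uniform_bounds (Function.invFunOn g U) (g '' U) (g '' Kc) hUo hKc' hKcU' hfd hfi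
  set f : ℂ → ℂ := Function.invFunOn g U with hfdef
  -- Step 3: constants.
  have hL1 : 0 < 2 * (L + 1) := by positivity
  refine ⟨min (min r₁ r₁') (m / (2 * (L + 1))), max (max Λ₀ (2 / m)) (max Λ' 1),
    lt_min (lt_min hr₁ hr₁') (div_pos hm hL1), (le_max_right _ _).trans (le_max_right _ _), ?_⟩
  set Λ : ℝ := max (max Λ₀ (2 / m)) (max Λ' 1) with hΛdef
  set r : ℝ := min (min r₁ r₁') (m / (2 * (L + 1))) with hrdef
  have hΛ₀Λ : Λ₀ ≤ Λ := (le_max_left _ _).trans (le_max_left _ _)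
  have h2mΛ : 2 / m ≤ Λ := (le_max_right _ _).trans (le_max_left _ _)
  have hΛ'Λ : Λ' ≤ Λ := (le_max_left _ _).trans (le_max_right _ _)
  have h1Λ : 1 ≤ Λ := (le_max_right _ _).trans (le_max_right _ _)
  have hrr₁ : r ≤ r₁ := (min_le_left _ _).trans (min_le_left _ _)
  have hrr₁' : r ≤ r₁' := (min_le_left _ _).trans (min_le_right _ _)
  have hrm : r ≤ m / (2 * (L + 1)) := min_le_right _ _
  have hr : 0 < r := lt_min (lt_min hr₁ hr₁') (div_pos hm hL1)
  have hLr : L * r ≤ m / 2 := by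
    have h := (le_div_iff₀ hL1).1 hrm
    nlinarith [h, hr.le, hL]
  have hsub : ∀ x ∈ Kc, closedBall x r ⊆ closedBall x r₁ := fun x _ =>
    closedBall_subset_closedBall hrr₁
  -- Step 4: upper Lipschitz bound on the big balls (mean value inequality, `‖deriv g‖ ≤ Λ₀`).
  have hup : ∀ x ∈ Kc, ∀ z ∈ closedBall x r₁, ∀ w ∈ closedBall x r₁,
      dist (g z) (g w) ≤ Λ₀ * dist z w := by
    intro x hx z hz w hw
    rw [dist_eq_norm, dist_eq_norm]
    exact (convex_closedBall x r₁).norm_image_sub_le_of_norm_hasDerivWithin_le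
      (fun y hy => (hder x hx y hy).1.hasDerivWithinAt) (fun y hy => (hder x hx y hy).2.2.2.1) hw hz
  -- Step 5: `deriv g` is `L`-Lipschitz from the centre on the big balls.
  have hdg : ∀ x ∈ Kc, ∀ y ∈ closedBall x r₁, ‖deriv g y - deriv g x‖ ≤ L * ‖y - x‖ := by
    intro x hx y hy
    exact (convex_closedBall x r₁).norm_image_sub_le_of_norm_hasDerivWithin_le
      (fun y hy => (hder x hx y hy).2.1.hasDerivWithinAt) (fun y hy => (hder x hx y hy).2.2.2.2)
      (mem_closedBall_self hr₁.le) hy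
  -- Step 6: lower Lipschitz bound on the small balls.
  have hlow : ∀ x ∈ Kc, ∀ z ∈ closedBall x r, ∀ w ∈ closedBall x r,
      dist z w ≤ (2 / m) * dist (g z) (g w) := by
    intro x hx z hz w hw
    have hε : ∀ y ∈ closedBall x r, ‖deriv g y - deriv g x‖ ≤ m / 2 := by
      intro y hy
      have hyx : ‖y - x‖ ≤ r := by rwa [← dist_eq_norm, ← mem_closedBall]
      calc ‖deriv g y - deriv g x‖ ≤ L * ‖y - x‖ := hdg x hx y (hsub x hx hy)
        _ ≤ L * r := mul_le_mul_of_nonneg_left hyx hL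
        _ ≤ m / 2 := hLr
    have key := tb_lower_bound (convex_closedBall x r)
      (fun y hy => (hder x hx y (hsub x hx hy)).1)
      (hder x hx x (mem_closedBall_self hr₁.le)).2.2.1 hε hz hw
    rw [dist_eq_norm, dist_eq_norm]
    have h2 : m * ‖z - w‖ ≤ 2 * ‖g z - g w‖ := by linarith
    calc ‖z - w‖ = (1 / m) * (m * ‖z - w‖) := by field_simp
      _ ≤ (1 / m) * (2 * ‖g z - g w‖) :=
          mul_le_mul_of_nonneg_left h2 (by positivity)
      _ = 2 / m * ‖g z - g w‖ := by ring
  -- Step 7: local surjectivity through the inverse `f`.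
  have hsurj : ∀ x ∈ Kc, ∀ ρ : ℝ, 0 ≤ ρ → Λ * ρ ≤ r →
      closedBall (g x) ρ ⊆ g '' closedBall x (Λ * ρ) := by
    intro x hx ρ hρ hΛρ w hw
    have hgx : g x ∈ g '' Kc := mem_image_of_mem g hx
    have hρr₁' : ρ ≤ r₁' := by
      have : ρ ≤ Λ * ρ := le_mul_of_one_le_left hρ h1Λ
      linarith
    have hw' : w ∈ closedBall (g x) r₁' := closedBall_subset_closedBall hρr₁' hw
    have hwU : w ∈ g '' U := hballU' (g x) hgx hw'
    refine ⟨f w, ?_, hgf w hwU⟩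
    rw [mem_closedBall, dist_eq_norm]
    have hfx : f (g x) = x := hfg x (hKcU hx)
    have key : ‖f w - f (g x)‖ ≤ Λ' * ‖w - g x‖ :=
      (convex_closedBall (g x) r₁').norm_image_sub_le_of_norm_hasDerivWithin_le
        (fun y hy => (hder' (g x) hgx y hy).1.hasDerivWithinAt)
        (fun y hy => (hder' (g x) hgx y hy).2.2.2.1) (mem_closedBall_self hr₁'.le) hw'
    rw [hfx] at key
    have hwρ : ‖w - g x‖ ≤ ρ := by rwa [← dist_eq_norm, ← mem_closedBall]
    have hΛ'0 : 0 ≤ Λ' := hm'.le.trans hmΛ'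
    calc ‖f w - x‖ ≤ Λ' * ‖w - g x‖ := key
      _ ≤ Λ' * ρ := mul_le_mul_of_nonneg_left hwρ hΛ'0
      _ ≤ Λ * ρ := mul_le_mul_of_nonneg_right hΛ'Λ hρ
  -- Step 8: assembly.
  refine ⟨fun x hx => (hsub x hx).trans (hballU x hx), ?_, ?_, hsurj, ?_⟩
  · intro x hx z hz w hw
    exact (hup x hx z (hsub x hx hz) w (hsub x hx hw)).trans
      (mul_le_mul_of_nonneg_right hΛ₀Λ dist_nonneg)
  · intro x hx z hz w hw
    exact (hlow x hx z hz w hw).trans (mul_le_mul_of_nonneg_right h2mΛ dist_nonneg)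
  · intro R₁ hR₁
    obtain ⟨η, hη, hηle⟩ := hinj R₁ hR₁
    exact ⟨η, hη, fun x hx z hz w hw hzw => hηle x hx z (hsub x hx hz) w (hsub x hx hw) hzw⟩

end Summit.CriticalPhenomena.CardyFormulaZ2.Cruxes.VoronoiHubFromSmirnov.MoebiusExactDelaunayDilationWard
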